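import Summits.Ventures.Crystal3D.Theorems.StickyWulffConstantNoReconstructionGainSlabForm
import Summits.Ventures.Crystal3D.Theorems.StickyWulffConstantNoReconstructionGainClosureOrbit
import Summits.Ventures.Crystal3D.Theorems.StickyWulffConstantNoReconstructionGainBasalBarlowFilmOrbit
import HarnessLib

/-!
# Single-family Barlow films on the `ν`-slab sample: the three regimes in SLAB FORM (`C ρ` rim term)

HONEST FRAMING. Part of the venture `Summits/Ventures/Crystal3D` (cell `crystal3d-full`), helper
`--supports` the crux `NoReconstructionGain` (stmt-Ventures-19144, route
`route-Ventures-StickyWulffConstant`), line `adhesion`; assembles `…SlabForm`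
(`slabForm_of_localClosure`: the rim costs `≤ 18432 ρ`) with the closure-form certificates
`oneOverhang_main` (`C = 1`), `twoOverhang_main` (`C = 2`) and a substrate-free form of the layer
order (`nTilt_main`, `C = 0`, via `basalCut_cross_le`).  The results are genuine special cases of the
atom `stub_adhesion` (`R = 2`, `C = 18432`): the hypotheses are ONLY on `ν` (regime, `ν₃ ≥ 0`) and
on the film (basal-family Barlow positions, above the cut) — no closure hypothesis:

* `clos_of_list`, `nTilt_main` — bookkeeping / the `C = 0` certificate for a given configuration;
* `nTiltBarlowFilm_slab`, `oneOverhangBarlowFilm_slab`, `twoOverhangBarlowFilm_slab` (**rungs**,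
  registered by name): for every unit `ν` with `ν₃ ≥ 0` in regime `C = 0`, `1`, `2` respectively,
  every `ρ ≥ 2` and every finite unit packing `X ⊇ P` around the `ν`-slab sample
  `P = Λ₀ ∩ {−4 ≤ ⟪·,ν⟫ ≤ −2, lateral ≤ ρ}` whose film lies in `B = Λ₀ ∪ (Λ₀ ± w)` above the cut:
  `#cross(P, X \ P) ≤ contactDeficiency (X \ P) + 18432 ρ`.

So, for the basal family and the hemisphere `ν₃ ≥ 0`, the atom of `NoReconstructionGain` HOLDS for
all single-family Barlow films at every normal off the three tie circles
`√(2/3) ν₃ + ⟪τ, ν⟫ = 0` (other families / hemisphere: transport as in `…ClosureOrbit`, not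
repeated here).

WHAT THIS IS NOT: the tie circles; films mixing families (multi-family slot rules: LP + explicit
recipe verified numerically, lead folder jobs/slot4); off-Barlow films; rung F-C1 not moved.
-/

noncomputable section

namespace Summit.Ventures.Crystal3D.Theorems

open Summit.Ventures.Crystal3D Finset
open Literature.MathematicalPhysics.StatisticalMechanics (barlowPos barlowStacking fccStacking
  barlowOffset layerNormal constHagg haggLabel_const barlowPos_apply_two orderedContacts contactDeficiency)
open scoped InnerProductSpace

/-- From the twelve-vector closure list: `p + (N + τ) ∈ P` if `N + τ` is `ν`-downward, and
`p − (N + τ) ∈ P` if it is `ν`-upward, at film-adjacent substrate balls. -/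
theorem clos_of_list (ν : EuclideanSpace ℝ (Fin 3)) (X P : Finset (EuclideanSpace ℝ (Fin 3)))
    (hclos : ∀ p ∈ P, ∀ q ∈ X \ P, dist p q = 1 →
      ∀ d ∈ ([barlowPos 1 (Real.sqrt (2 / 3)) constHagg 0 1 0, -barlowPos 1 (Real.sqrt (2 / 3)) constHagg 0 1 0,
            barlowPos 1 (Real.sqrt (2 / 3)) constHagg 0 0 1, -barlowPos 1 (Real.sqrt (2 / 3)) constHagg 0 0 1,
            barlowPos 1 (Real.sqrt (2 / 3)) constHagg 0 1 (-1), -barlowPos 1 (Real.sqrt (2 / 3)) constHagg 0 1 (-1),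
            barlowPos 1 (Real.sqrt (2 / 3)) constHagg 1 0 0, -barlowPos 1 (Real.sqrt (2 / 3)) constHagg 1 0 0,
            barlowPos 1 (Real.sqrt (2 / 3)) constHagg (-1) 1 0, -barlowPos 1 (Real.sqrt (2 / 3)) constHagg (-1) 1 0,
            barlowPos 1 (Real.sqrt (2 / 3)) constHagg (-1) 0 1, -barlowPos 1 (Real.sqrt (2 / 3)) constHagg (-1) 0 1] :
            List (EuclideanSpace ℝ (Fin 3))),
        ⟪d, ν⟫_ℝ < 0 → p + d ∈ P) :
    ∀ τ ∈ ([barlowOffset 1, barlowOffset 1 - barlowPos 1 (Real.sqrt (2 / 3)) constHagg 0 1 0,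
          barlowOffset 1 - barlowPos 1 (Real.sqrt (2 / 3)) constHagg 0 0 1] : List (EuclideanSpace ℝ (Fin 3))),
      (Real.sqrt (2 / 3) * ν 2 + ⟪τ, ν⟫_ℝ < 0 →
        ∀ p ∈ P, ∀ q ∈ X \ P, dist p q = 1 → p + (layerNormal (Real.sqrt (2 / 3)) + τ) ∈ P) ∧
      (0 < Real.sqrt (2 / 3) * ν 2 + ⟪τ, ν⟫_ℝ →
        ∀ p ∈ P, ∀ q ∈ X \ P, dist p q = 1 → p - (layerNormal (Real.sqrt (2 / 3)) + τ) ∈ P) := by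
  intro τ hτ
  obtain ⟨e1, e2, e3, -, -, -⟩ := polar_vectors_eq
  have hN := inner_layerNormal_left ν
  simp only [List.mem_cons, List.mem_nil_iff, or_false] at hτ
  rcases hτ with rfl | rfl | rfl
  · refine ⟨fun hlt p hp q hq hd => ?_, fun hgt p hp q hq hd => ?_⟩
    · rw [← e1]
      exact hclos p hp q hq hd _ (by simp) (by rw [e1, inner_add_left, hN]; exact hlt)
    · rw [← e1, sub_eq_add_neg]
      exact hclos p hp q hq hd _ (by simp) (by rw [inner_neg_left, e1, inner_add_left, hN]; linarith)
  · refine ⟨fun hlt p hp q hq hd => ?_, fun hgt p hp q hq hd => ?_⟩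
    · rw [show layerNormal (Real.sqrt (2 / 3)) + (barlowOffset 1 - barlowPos 1 (Real.sqrt (2 / 3)) constHagg 0 1 0)
          = -barlowPos 1 (Real.sqrt (2 / 3)) constHagg (-1) 1 0 by rw [e2, neg_neg]]
      exact hclos p hp q hq hd _ (by simp)
        (by rw [inner_neg_left, e2, inner_neg_left, inner_add_left, hN]; linarith)
    · rw [show p - (layerNormal (Real.sqrt (2 / 3)) + (barlowOffset 1 - barlowPos 1 (Real.sqrt (2 / 3)) constHagg 0 1 0))
          = p + barlowPos 1 (Real.sqrt (2 / 3)) constHagg (-1) 1 0 by rw [e2]; abel]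
      exact hclos p hp q hq hd _ (by simp) (by rw [e2, inner_neg_left, inner_add_left, hN]; linarith)
  · refine ⟨fun hlt p hp q hq hd => ?_, fun hgt p hp q hq hd => ?_⟩
    · rw [show layerNormal (Real.sqrt (2 / 3)) + (barlowOffset 1 - barlowPos 1 (Real.sqrt (2 / 3)) constHagg 0 0 1)
          = -barlowPos 1 (Real.sqrt (2 / 3)) constHagg (-1) 0 1 by rw [e3, neg_neg]]
      exact hclos p hp q hq hd _ (by simp)
        (by rw [inner_neg_left, e3, inner_neg_left, inner_add_left, hN]; linarith)
    · rw [show p - (layerNormal (Real.sqrt (2 / 3)) + (barlowOffset 1 - barlowPos 1 (Real.sqrt (2 / 3)) constHagg 0 0 1))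
          = p + barlowPos 1 (Real.sqrt (2 / 3)) constHagg (-1) 0 1 by rw [e3]; abel]
      exact hclos p hp q hq hd _ (by simp) (by rw [e3, inner_neg_left, inner_add_left, hN]; linarith)

/-- **The layer-order certificate for a given configuration** (regime `C = 0`, substrate-free form
via `basalCut_cross_le`): film in `B`, substrate `ν`-below the film, all registry-up slots
`ν`-upward, registry-down neighbours of film-adjacent substrate balls in `P`. -/
theorem nTilt_main (X P : Finset (EuclideanSpace ℝ (Fin 3)))
    (hX : ∀ p ∈ X, ∀ q ∈ X, p ≠ q → 1 ≤ dist p q) (hPX : P ⊆ X)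
    (ν : EuclideanSpace ℝ (Fin 3)) (hν : ‖ν‖ = 1)
    (hPΛ : ∀ p ∈ P, p ∈ fccStacking 1 (Real.sqrt (2 / 3)))
    (hfilm : ∀ q ∈ X \ P, q ∈ fccStacking 1 (Real.sqrt (2 / 3)) ∨
      q - barlowOffset 1 ∈ fccStacking 1 (Real.sqrt (2 / 3)) ∨
      q + barlowOffset 1 ∈ fccStacking 1 (Real.sqrt (2 / 3)))
    (hbelow : ∀ p ∈ P, ∀ q ∈ X \ P, ⟪p, ν⟫_ℝ < ⟪q, ν⟫_ℝ)
    (hC0 : ∀ τ ∈ ([barlowOffset 1, barlowOffset 1 - barlowPos 1 (Real.sqrt (2 / 3)) constHagg 0 1 0,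
          barlowOffset 1 - barlowPos 1 (Real.sqrt (2 / 3)) constHagg 0 0 1] : List (EuclideanSpace ℝ (Fin 3))),
        0 < Real.sqrt (2 / 3) * ν 2 + ⟪τ, ν⟫_ℝ)
    (hclos : ∀ p ∈ P, ∀ q ∈ X \ P, dist p q = 1 →
      ∀ τ ∈ ([barlowOffset 1, barlowOffset 1 - barlowPos 1 (Real.sqrt (2 / 3)) constHagg 0 1 0,
          barlowOffset 1 - barlowPos 1 (Real.sqrt (2 / 3)) constHagg 0 0 1] : List (EuclideanSpace ℝ (Fin 3))),
        p - layerNormal (Real.sqrt (2 / 3)) - τ ∈ P) :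
    ((((P ×ˢ (X \ P)).filter fun pq => dist pq.1 pq.2 = 1).card : ℕ) : ℝ) ≤
      contactDeficiency (X \ P) := by
  classical
  set Tl : List (EuclideanSpace ℝ (Fin 3)) := [barlowOffset 1,
    barlowOffset 1 - barlowPos 1 (Real.sqrt (2 / 3)) constHagg 0 1 0,
    barlowOffset 1 - barlowPos 1 (Real.sqrt (2 / 3)) constHagg 0 0 1] with hTl
  have hB : ∀ y ∈ X, y ∈ fccStacking 1 (Real.sqrt (2 / 3)) ∨
      y - barlowOffset 1 ∈ fccStacking 1 (Real.sqrt (2 / 3)) ∨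
      y + barlowOffset 1 ∈ fccStacking 1 (Real.sqrt (2 / 3)) := by
    intro y hy
    by_cases hyP : y ∈ P
    · exact Or.inl (hPΛ y hyP)
    · exact hfilm y (mem_sdiff.2 ⟨hy, hyP⟩)
  have hh : 0 < Real.sqrt (2 / 3) := Real.sqrt_pos.2 (by norm_num)
  -- the tilted grading `ν' ∝ ν + 10 e₃`
  set e₃ : EuclideanSpace ℝ (Fin 3) := EuclideanSpace.single (2 : Fin 3) (1 : ℝ) with he₃
  set V : EuclideanSpace ℝ (Fin 3) := ν + (10 : ℝ) • e₃ with hV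
  have hin3 : ∀ u : EuclideanSpace ℝ (Fin 3), ⟪u, e₃⟫_ℝ = u 2 := fun u => by
    simp [he₃, EuclideanSpace.inner_single_right]
  have he₃n : ‖e₃‖ = 1 := by simp [he₃]
  have hν2 : -1 ≤ ν 2 := by
    have h1 : |⟪ν, e₃⟫_ℝ| ≤ ‖ν‖ * ‖e₃‖ := abs_real_inner_le_norm ν e₃
    rw [hin3, hν, he₃n, one_mul] at h1
    linarith [neg_abs_le (ν 2)]
  have hVV : ‖V‖ ^ 2 = 101 + 20 * ν 2 := by
    rw [hV, norm_add_sq_real, norm_smul, real_inner_smul_right, hin3, hν, he₃n, Real.norm_eq_abs,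
      abs_of_pos (by norm_num : (0 : ℝ) < 10)]
    ring
  have hVpos : 0 < ‖V‖ := by nlinarith [norm_nonneg V, hVV, hν2]
  set L : ℝ := ‖V‖ with hL
  set ν' : EuclideanSpace ℝ (Fin 3) := L⁻¹ • V with hν'
  have hν'n : ‖ν'‖ = 1 := by
    rw [hν', norm_smul, Real.norm_eq_abs, abs_inv, abs_of_pos hVpos, inv_mul_cancel₀ hVpos.ne']
  have hinner' : ∀ u : EuclideanSpace ℝ (Fin 3), ⟪u, ν'⟫_ℝ = L⁻¹ * (⟪u, ν⟫_ℝ + 10 * u 2) := fun u => by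
    rw [hν', real_inner_smul_right, hV, inner_add_right, real_inner_smul_right, hin3]
  have hν'2 : 1 / 3 < ν' 2 ^ 2 := by
    have e : ν' 2 = L⁻¹ * (ν 2 + 10) := by simp [hν', hV, he₃]; ring
    have key : L ^ 2 < 3 * (ν 2 + 10) ^ 2 := by rw [hL, hVV]; nlinarith [hν2]
    have hL2 : 0 < L ^ 2 := by positivity
    rw [e, mul_pow, inv_pow, ← div_eq_inv_mul, lt_div_iff₀ hL2]
    linarith
  -- substrate–film contacts are `ν'`-upward
  have hplug' : ∀ q ∈ X \ P, ∀ p ∈ P, dist q p = 1 → ⟪p, ν'⟫_ℝ < ⟪q, ν'⟫_ℝ := by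
    intro q hq p hp hd
    rw [hinner', hinner']
    refine mul_lt_mul_of_pos_left ?_ (inv_pos.2 hVpos)
    have hpΛ := hPΛ p hp
    have hqP : q ∉ P := (mem_sdiff.1 hq).2
    have hqX : q ∈ X := (mem_sdiff.1 hq).1
    have hup : 0 < ⟪q, ν⟫_ℝ - ⟪p, ν⟫_ℝ := by linarith [hbelow p hp q hq]
    have hd' : dist p q = 1 := by rw [dist_comm]; exact hd
    have h18 := basal_unit_vectors (Or.inl hpΛ) (hfilm q hq) hd'
    have hsub2 : (q - p) 2 = q 2 - p 2 := by simp
    rcases basal_polar_or_inplane h18 with ⟨c, hc, hcq⟩ | ⟨τ, hτ, hτq⟩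
    · -- in-plane: same layer
      have h2 : (q - p) 2 = 0 := by
        simp only [List.mem_cons, List.mem_nil_iff, or_false] at hc
        rcases hc with rfl | rfl | rfl <;> rcases hcq with e | e <;> simp [e, barlowPos_apply_two]
      rw [hsub2] at h2
      linarith
    · have hτ2 := hollow_apply_two hτ
      have hN2 := layerNormal_apply_two
      rcases hτq with e | e | e | e
      · -- `q − p = N + τ`: one layer up
        have h2 : (q - p) 2 = Real.sqrt (2 / 3) := by rw [e, PiLp.add_apply, hN2, hτ2, add_zero]
        rw [hsub2] at h2
        linarith
      · -- `q − p = N − τ`: one layer up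
        have h2 : (q - p) 2 = Real.sqrt (2 / 3) := by rw [e, PiLp.sub_apply, hN2, hτ2, sub_zero]
        rw [hsub2] at h2
        linarith
      · -- `q − p = −(N + τ)`: a registry overhang, impossible since `α + β_τ > 0`
        exfalso
        have hc := hC0 τ hτ
        have : ⟪q - p, ν⟫_ℝ = -(Real.sqrt (2 / 3) * ν 2 + ⟪τ, ν⟫_ℝ) := by
          rw [e, inner_neg_left, inner_add_left, inner_layerNormal_left]
        rw [inner_sub_left] at this
        linarith
      · -- `q − p = −(N − τ)`: a twin overhang; the registry-down neighbour `p − N − τ'` of `p` is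
        -- within `√(1/3)` of `q`
        exfalso
        -- a second hollow vector `τ'` with `‖τ + τ'‖² = 1/3`
        obtain ⟨τ', hτ', hn⟩ : ∃ τ' ∈ Tl, ‖τ + τ'‖ ^ 2 = 1 / 3 := by
          have hsum := hollow_triple_sum
          simp only [List.mem_cons, List.mem_nil_iff, or_false] at hτ
          rcases hτ with rfl | rfl | rfl
          · refine ⟨barlowOffset 1 - barlowPos 1 (Real.sqrt (2 / 3)) constHagg 0 1 0, by simp [hTl], ?_⟩
            rw [show barlowOffset 1 + (barlowOffset 1 - barlowPos 1 (Real.sqrt (2 / 3)) constHagg 0 1 0) =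
              -(barlowOffset 1 - barlowPos 1 (Real.sqrt (2 / 3)) constHagg 0 0 1) by
                rw [← sub_eq_zero]; rw [← hsum]; abel, norm_neg]
            exact norm_sq_barlowOffset_sub_v
          · refine ⟨barlowOffset 1 - barlowPos 1 (Real.sqrt (2 / 3)) constHagg 0 0 1, by simp [hTl], ?_⟩
            rw [show barlowOffset 1 - barlowPos 1 (Real.sqrt (2 / 3)) constHagg 0 1 0 +
                (barlowOffset 1 - barlowPos 1 (Real.sqrt (2 / 3)) constHagg 0 0 1) = -barlowOffset 1 by
                rw [← sub_eq_zero]; rw [← hsum]; abel, norm_neg]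
            exact norm_sq_barlowOffset'
          · refine ⟨barlowOffset 1, by simp [hTl], ?_⟩
            rw [show barlowOffset 1 - barlowPos 1 (Real.sqrt (2 / 3)) constHagg 0 0 1 + barlowOffset 1 =
              -(barlowOffset 1 - barlowPos 1 (Real.sqrt (2 / 3)) constHagg 0 1 0) by
                rw [← sub_eq_zero]; rw [← hsum]; abel, norm_neg]
            exact norm_sq_barlowOffset_sub_u
        have hℓP : p - layerNormal (Real.sqrt (2 / 3)) - τ' ∈ P := hclos p hp q hq hd' τ' hτ'
        have hℓX : p - layerNormal (Real.sqrt (2 / 3)) - τ' ∈ X := hPX hℓP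
        have hne : q ≠ p - layerNormal (Real.sqrt (2 / 3)) - τ' := fun hqe => hqP (hqe ▸ hℓP)
        have h1 := hX q hqX _ hℓX hne
        have hdq : q - (p - layerNormal (Real.sqrt (2 / 3)) - τ') = τ + τ' := by
          have : q = p + (q - p) := by abel
          rw [this, e]; abel
        rw [dist_eq_norm, hdq] at h1
        nlinarith [norm_nonneg (τ + τ')]
  exact basalCut_cross_le ν' hν'n hν'2 X P hX hPX hB fun p hp q hq hd => hplug' q hq p hp hd

/-- **Slab form, regime `C = 0`** (layer order; `R = 2`, `C = 18432`; registered by name). -/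
theorem nTiltBarlowFilm_slab :
    ∃ R C : ℝ, 1 ≤ R ∧ ∀ ν : EuclideanSpace ℝ (Fin 3), ‖ν‖ = 1 → ∀ ρ : ℝ, R ≤ ρ →
      ∀ X P : Finset (EuclideanSpace ℝ (Fin 3)),
      (∀ p ∈ X, ∀ q ∈ X, p ≠ q → 1 ≤ dist p q) → P ⊆ X →
      (∀ p, p ∈ P ↔ (p ∈ fccStacking 1 (Real.sqrt (2 / 3)) ∧ -(2 * R) ≤ ⟪p, ν⟫_ℝ ∧
        ⟪p, ν⟫_ℝ ≤ -R ∧ ‖p‖ ^ 2 - ⟪p, ν⟫_ℝ ^ 2 ≤ ρ ^ 2)) →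
      0 ≤ ν 2 →
      (∀ τ ∈ ([barlowOffset 1, barlowOffset 1 - barlowPos 1 (Real.sqrt (2 / 3)) constHagg 0 1 0,
          barlowOffset 1 - barlowPos 1 (Real.sqrt (2 / 3)) constHagg 0 0 1] : List (EuclideanSpace ℝ (Fin 3))),
        0 < Real.sqrt (2 / 3) * ν 2 + ⟪τ, ν⟫_ℝ) →
      (∀ q ∈ X \ P, q ∈ fccStacking 1 (Real.sqrt (2 / 3)) ∨
        q - barlowOffset 1 ∈ fccStacking 1 (Real.sqrt (2 / 3)) ∨
        q + barlowOffset 1 ∈ fccStacking 1 (Real.sqrt (2 / 3))) →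
      (∀ q ∈ X \ P, -R < ⟪q, ν⟫_ℝ) →
      ((((P ×ˢ (X \ P)).filter fun pq => dist pq.1 pq.2 = 1).card : ℕ) : ℝ) ≤
        contactDeficiency (X \ P) + C * ρ := by
  classical
  refine ⟨2, 18432, by norm_num, fun ν hν ρ hρ X P hX hPX hP hν2 hreg hfilm habove => ?_⟩
  refine slabForm_of_localClosure ν hν ρ hρ X P hX hPX hP habove fun X' hPX' hX'X hclos' => ?_
  have hX' : ∀ p ∈ X', ∀ q ∈ X', p ≠ q → 1 ≤ dist p q := fun p hp q hq => hX p (hX'X hp) q (hX'X hq)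
  have hPΛ : ∀ p ∈ P, p ∈ fccStacking 1 (Real.sqrt (2 / 3)) := fun p hp => ((hP p).1 hp).1
  have hfilm' : ∀ q ∈ X' \ P, q ∈ fccStacking 1 (Real.sqrt (2 / 3)) ∨
      q - barlowOffset 1 ∈ fccStacking 1 (Real.sqrt (2 / 3)) ∨
      q + barlowOffset 1 ∈ fccStacking 1 (Real.sqrt (2 / 3)) := fun q hq =>
    hfilm q (mem_sdiff.2 ⟨hX'X (mem_sdiff.1 hq).1, (mem_sdiff.1 hq).2⟩)
  have hbelow : ∀ p ∈ P, ∀ q ∈ X' \ P, ⟪p, ν⟫_ℝ < ⟪q, ν⟫_ℝ := fun p hp q hq => by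
    obtain ⟨-, -, h2, -⟩ := (hP p).1 hp
    linarith [habove q (mem_sdiff.2 ⟨hX'X (mem_sdiff.1 hq).1, (mem_sdiff.1 hq).2⟩)]
  have hs0 : 0 ≤ Real.sqrt (2 / 3) * ν 2 := mul_nonneg (Real.sqrt_nonneg _) hν2
  have hsum : barlowOffset 1 + (barlowOffset 1 - barlowPos 1 (Real.sqrt (2 / 3)) constHagg 0 1 0) +
      (barlowOffset 1 - barlowPos 1 (Real.sqrt (2 / 3)) constHagg 0 0 1) = 0 := hollow_triple_sum
  have clos := clos_of_list ν X' P hclos'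
  refine nTilt_main X' P hX' hPX' ν hν hPΛ hfilm' hbelow hreg fun p hp q hq hd τ hτ => ?_
  have := (clos τ hτ).2 (hreg τ hτ) p hp q hq hd
  rw [show p - layerNormal (Real.sqrt (2 / 3)) - τ = p - (layerNormal (Real.sqrt (2 / 3)) + τ) by abel]
  exact this

/-- **Slab form, regime `C = 1`** (the `A`-rule flow; `R = 2`, `C = 18432`; registered by name). -/
theorem oneOverhangBarlowFilm_slab :
    ∃ R C : ℝ, 1 ≤ R ∧ ∀ ν : EuclideanSpace ℝ (Fin 3), ‖ν‖ = 1 → ∀ ρ : ℝ, R ≤ ρ →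
      ∀ X P : Finset (EuclideanSpace ℝ (Fin 3)),
      (∀ p ∈ X, ∀ q ∈ X, p ≠ q → 1 ≤ dist p q) → P ⊆ X →
      (∀ p, p ∈ P ↔ (p ∈ fccStacking 1 (Real.sqrt (2 / 3)) ∧ -(2 * R) ≤ ⟪p, ν⟫_ℝ ∧
        ⟪p, ν⟫_ℝ ≤ -R ∧ ‖p‖ ^ 2 - ⟪p, ν⟫_ℝ ^ 2 ≤ ρ ^ 2)) →
      0 ≤ ν 2 →
      ((Real.sqrt (2 / 3) * ν 2 + ⟪barlowOffset 1, ν⟫_ℝ < 0 ∧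
          0 < Real.sqrt (2 / 3) * ν 2 + ⟪barlowOffset 1 - barlowPos 1 (Real.sqrt (2 / 3)) constHagg 0 1 0, ν⟫_ℝ ∧
          0 < Real.sqrt (2 / 3) * ν 2 + ⟪barlowOffset 1 - barlowPos 1 (Real.sqrt (2 / 3)) constHagg 0 0 1, ν⟫_ℝ) ∨
        (Real.sqrt (2 / 3) * ν 2 + ⟪barlowOffset 1 - barlowPos 1 (Real.sqrt (2 / 3)) constHagg 0 1 0, ν⟫_ℝ < 0 ∧
          0 < Real.sqrt (2 / 3) * ν 2 + ⟪barlowOffset 1, ν⟫_ℝ ∧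
          0 < Real.sqrt (2 / 3) * ν 2 + ⟪barlowOffset 1 - barlowPos 1 (Real.sqrt (2 / 3)) constHagg 0 0 1, ν⟫_ℝ) ∨
        (Real.sqrt (2 / 3) * ν 2 + ⟪barlowOffset 1 - barlowPos 1 (Real.sqrt (2 / 3)) constHagg 0 0 1, ν⟫_ℝ < 0 ∧
          0 < Real.sqrt (2 / 3) * ν 2 + ⟪barlowOffset 1, ν⟫_ℝ ∧
          0 < Real.sqrt (2 / 3) * ν 2 + ⟪barlowOffset 1 - barlowPos 1 (Real.sqrt (2 / 3)) constHagg 0 1 0, ν⟫_ℝ)) →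
      (∀ q ∈ X \ P, q ∈ fccStacking 1 (Real.sqrt (2 / 3)) ∨
        q - barlowOffset 1 ∈ fccStacking 1 (Real.sqrt (2 / 3)) ∨
        q + barlowOffset 1 ∈ fccStacking 1 (Real.sqrt (2 / 3))) →
      (∀ q ∈ X \ P, -R < ⟪q, ν⟫_ℝ) →
      ((((P ×ˢ (X \ P)).filter fun pq => dist pq.1 pq.2 = 1).card : ℕ) : ℝ) ≤
        contactDeficiency (X \ P) + C * ρ := by
  classical
  refine ⟨2, 18432, by norm_num, fun ν hν ρ hρ X P hX hPX hP hν2 hreg hfilm habove => ?_⟩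
  refine slabForm_of_localClosure ν hν ρ hρ X P hX hPX hP habove fun X' hPX' hX'X hclos' => ?_
  have hX' : ∀ p ∈ X', ∀ q ∈ X', p ≠ q → 1 ≤ dist p q := fun p hp q hq => hX p (hX'X hp) q (hX'X hq)
  have hPΛ : ∀ p ∈ P, p ∈ fccStacking 1 (Real.sqrt (2 / 3)) := fun p hp => ((hP p).1 hp).1
  have hfilm' : ∀ q ∈ X' \ P, q ∈ fccStacking 1 (Real.sqrt (2 / 3)) ∨
      q - barlowOffset 1 ∈ fccStacking 1 (Real.sqrt (2 / 3)) ∨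
      q + barlowOffset 1 ∈ fccStacking 1 (Real.sqrt (2 / 3)) := fun q hq =>
    hfilm q (mem_sdiff.2 ⟨hX'X (mem_sdiff.1 hq).1, (mem_sdiff.1 hq).2⟩)
  have hbelow : ∀ p ∈ P, ∀ q ∈ X' \ P, ⟪p, ν⟫_ℝ < ⟪q, ν⟫_ℝ := fun p hp q hq => by
    obtain ⟨-, -, h2, -⟩ := (hP p).1 hp
    linarith [habove q (mem_sdiff.2 ⟨hX'X (mem_sdiff.1 hq).1, (mem_sdiff.1 hq).2⟩)]
  have hs0 : 0 ≤ Real.sqrt (2 / 3) * ν 2 := mul_nonneg (Real.sqrt_nonneg _) hν2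
  have hsum : barlowOffset 1 + (barlowOffset 1 - barlowPos 1 (Real.sqrt (2 / 3)) constHagg 0 1 0) +
      (barlowOffset 1 - barlowPos 1 (Real.sqrt (2 / 3)) constHagg 0 0 1) = 0 := hollow_triple_sum
  have clos := clos_of_list ν X' P hclos'
  rcases hreg with ⟨ha, hb, hc⟩ | ⟨ha, hb, hc⟩ | ⟨ha, hb, hc⟩
  · exact oneOverhang_main X' P hX' hPX' ν _ _ _ hPΛ hfilm' hbelow
      (fun τ hτ => by simp only [List.mem_cons, List.mem_nil_iff, or_false] at hτ; tauto)
      (by simp) (by simp) (by simp) hsum hs0 ha hb hc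
      ((clos _ (by simp)).1 ha) ((clos _ (by simp)).2 hb)
  · exact oneOverhang_main X' P hX' hPX' ν _ _ _ hPΛ hfilm' hbelow
      (fun τ hτ => by simp only [List.mem_cons, List.mem_nil_iff, or_false] at hτ; tauto)
      (by simp) (by simp) (by simp) (by rw [← hsum]; abel) hs0 ha hb hc
      ((clos _ (by simp)).1 ha) ((clos _ (by simp)).2 hb)
  · exact oneOverhang_main X' P hX' hPX' ν _ _ _ hPΛ hfilm' hbelow
      (fun τ hτ => by simp only [List.mem_cons, List.mem_nil_iff, or_false] at hτ; tauto)
      (by simp) (by simp) (by simp) (by rw [← hsum]; abel) hs0 ha hb hc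
      ((clos _ (by simp)).1 ha) ((clos _ (by simp)).2 hb)

/-- **Slab form, regime `C = 2`** (the `M`-rule flow; `R = 2`, `C = 18432`; registered by name). -/
theorem twoOverhangBarlowFilm_slab :
    ∃ R C : ℝ, 1 ≤ R ∧ ∀ ν : EuclideanSpace ℝ (Fin 3), ‖ν‖ = 1 → ∀ ρ : ℝ, R ≤ ρ →
      ∀ X P : Finset (EuclideanSpace ℝ (Fin 3)),
      (∀ p ∈ X, ∀ q ∈ X, p ≠ q → 1 ≤ dist p q) → P ⊆ X →
      (∀ p, p ∈ P ↔ (p ∈ fccStacking 1 (Real.sqrt (2 / 3)) ∧ -(2 * R) ≤ ⟪p, ν⟫_ℝ ∧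
        ⟪p, ν⟫_ℝ ≤ -R ∧ ‖p‖ ^ 2 - ⟪p, ν⟫_ℝ ^ 2 ≤ ρ ^ 2)) →
      0 ≤ ν 2 →
      ((0 < Real.sqrt (2 / 3) * ν 2 + ⟪barlowOffset 1, ν⟫_ℝ ∧
          Real.sqrt (2 / 3) * ν 2 + ⟪barlowOffset 1 - barlowPos 1 (Real.sqrt (2 / 3)) constHagg 0 1 0, ν⟫_ℝ < 0 ∧
          Real.sqrt (2 / 3) * ν 2 + ⟪barlowOffset 1 - barlowPos 1 (Real.sqrt (2 / 3)) constHagg 0 0 1, ν⟫_ℝ < 0) ∨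
        (0 < Real.sqrt (2 / 3) * ν 2 + ⟪barlowOffset 1 - barlowPos 1 (Real.sqrt (2 / 3)) constHagg 0 1 0, ν⟫_ℝ ∧
          Real.sqrt (2 / 3) * ν 2 + ⟪barlowOffset 1, ν⟫_ℝ < 0 ∧
          Real.sqrt (2 / 3) * ν 2 + ⟪barlowOffset 1 - barlowPos 1 (Real.sqrt (2 / 3)) constHagg 0 0 1, ν⟫_ℝ < 0) ∨
        (0 < Real.sqrt (2 / 3) * ν 2 + ⟪barlowOffset 1 - barlowPos 1 (Real.sqrt (2 / 3)) constHagg 0 0 1, ν⟫_ℝ ∧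
          Real.sqrt (2 / 3) * ν 2 + ⟪barlowOffset 1, ν⟫_ℝ < 0 ∧
          Real.sqrt (2 / 3) * ν 2 + ⟪barlowOffset 1 - barlowPos 1 (Real.sqrt (2 / 3)) constHagg 0 1 0, ν⟫_ℝ < 0)) →
      (∀ q ∈ X \ P, q ∈ fccStacking 1 (Real.sqrt (2 / 3)) ∨
        q - barlowOffset 1 ∈ fccStacking 1 (Real.sqrt (2 / 3)) ∨
        q + barlowOffset 1 ∈ fccStacking 1 (Real.sqrt (2 / 3))) →
      (∀ q ∈ X \ P, -R < ⟪q, ν⟫_ℝ) →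
      ((((P ×ˢ (X \ P)).filter fun pq => dist pq.1 pq.2 = 1).card : ℕ) : ℝ) ≤
        contactDeficiency (X \ P) + C * ρ := by
  classical
  refine ⟨2, 18432, by norm_num, fun ν hν ρ hρ X P hX hPX hP hν2 hreg hfilm habove => ?_⟩
  refine slabForm_of_localClosure ν hν ρ hρ X P hX hPX hP habove fun X' hPX' hX'X hclos' => ?_
  have hX' : ∀ p ∈ X', ∀ q ∈ X', p ≠ q → 1 ≤ dist p q := fun p hp q hq => hX p (hX'X hp) q (hX'X hq)
  have hPΛ : ∀ p ∈ P, p ∈ fccStacking 1 (Real.sqrt (2 / 3)) := fun p hp => ((hP p).1 hp).1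
  have hfilm' : ∀ q ∈ X' \ P, q ∈ fccStacking 1 (Real.sqrt (2 / 3)) ∨
      q - barlowOffset 1 ∈ fccStacking 1 (Real.sqrt (2 / 3)) ∨
      q + barlowOffset 1 ∈ fccStacking 1 (Real.sqrt (2 / 3)) := fun q hq =>
    hfilm q (mem_sdiff.2 ⟨hX'X (mem_sdiff.1 hq).1, (mem_sdiff.1 hq).2⟩)
  have hbelow : ∀ p ∈ P, ∀ q ∈ X' \ P, ⟪p, ν⟫_ℝ < ⟪q, ν⟫_ℝ := fun p hp q hq => by
    obtain ⟨-, -, h2, -⟩ := (hP p).1 hp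
    linarith [habove q (mem_sdiff.2 ⟨hX'X (mem_sdiff.1 hq).1, (mem_sdiff.1 hq).2⟩)]
  have hs0 : 0 ≤ Real.sqrt (2 / 3) * ν 2 := mul_nonneg (Real.sqrt_nonneg _) hν2
  have hsum : barlowOffset 1 + (barlowOffset 1 - barlowPos 1 (Real.sqrt (2 / 3)) constHagg 0 1 0) +
      (barlowOffset 1 - barlowPos 1 (Real.sqrt (2 / 3)) constHagg 0 0 1) = 0 := hollow_triple_sum
  have clos := clos_of_list ν X' P hclos'
  rcases hreg with ⟨hc, ha, hb⟩ | ⟨hc, ha, hb⟩ | ⟨hc, ha, hb⟩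
  · exact twoOverhang_main X' P hX' hPX' ν _ _ _ hPΛ hfilm' hbelow
      (fun τ hτ => by simp only [List.mem_cons, List.mem_nil_iff, or_false] at hτ; tauto)
      (by simp) (by simp) (by simp) (by rw [← hsum]; abel) hs0 ha hb hc
      ((clos _ (by simp)).1 ha)
  · exact twoOverhang_main X' P hX' hPX' ν _ _ _ hPΛ hfilm' hbelow
      (fun τ hτ => by simp only [List.mem_cons, List.mem_nil_iff, or_false] at hτ; tauto)
      (by simp) (by simp) (by simp) (by rw [← hsum]; abel) hs0 ha hb hc
      ((clos _ (by simp)).1 ha)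
  · exact twoOverhang_main X' P hX' hPX' ν _ _ _ hPΛ hfilm' hbelow
      (fun τ hτ => by simp only [List.mem_cons, List.mem_nil_iff, or_false] at hτ; tauto)
      (by simp) (by simp) (by simp) hsum hs0 ha hb hc
      ((clos _ (by simp)).1 ha)

end Summit.Ventures.Crystal3D.Theorems

end
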